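import Literature.MathematicalPhysics.KineticTheory.PureQuarticChainConfined
import Literature.MathematicalPhysics.KineticTheory.PureQuarticChainForcedEquilibrium
import Literature.MathematicalPhysics.KineticTheory.LangevinChainForcedLaSalle
import Literature.MathematicalPhysics.KineticTheory.ConfinedForcedMinorization
import Literature.Probability.Process.SmallSets
import Mathlib.MeasureTheory.Measure.Lebesgue.EqHaar
import HarnessLib

/-!
# CEHR Proposition 3.6 for the purely quartic chain: every compact set is small for all large times

Topic `Literature/MathematicalPhysics/KineticTheory` (trunk T-KINETIC). Proof file of the provefact
unit for `CuneoEckmannHairerReyBellet2018_thm213_pureQuartic` (`PureQuarticChainNESS.lean`).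
Cuneo–Eckmann–Hairer–Rey-Bellet, EJP **23** (2018) no. 55, Proposition 3.6 ("for every compact set
`C`, there exists a time `t_C` such that for all `t ≥ t_C`, there exists a non-negative and
non-trivial measure `ν` … such that `P_t(z, ·) ≥ ν` for all `z ∈ C`") for the transition kernels
`OscillatorChain.langevinKernel` of the purely quartic chain `pureQuarticChain μ γ = ⟨μq⁴/4, r⁴/4, γ⟩`
(`μ, γ, T_L > 0`, `T_R ≥ 0`, `N ≥ 1`). The printed proof uses the smooth transition densities of
Prop. 3.2; as for the pinned chain the tree proceeds Hörmander-free, but the local small set cannot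
be placed at the rest point `0` (degenerate linearisation): it is placed at the FORCED equilibrium
`x⋆ = (q⋆, 0)` of the chain pulled at its left end (`PureQuarticChainForcedEquilibrium.lean`), by the
model-free forced minorisation (`ConfinedForcedMinorization.lean`); irreducibility towards `x⋆` is
the forced LaSalle principle (`LangevinChainForcedLaSalle.lean`); the abstract small-set theorem
(`Literature/Probability/Process/SmallSets.lean`, pointed form) concludes. This file (all PROVED,
no definition, no named fact):

* `pureQuarticChain_eq_forcedRest_of_dPotential` — **uniqueness of the forced rest configuration**:
  a configuration at rest at all sites `i ≠ 0` whose left-end force equals that of `q⋆` IS `q⋆`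
  (back-substitution from the right end: it is a dilate `λ q⋆` by mechanical similarity, and the
  left-end force `λ³ ∂₀Φ(q⋆) > 0` fixes `λ = 1`);
* `pureQuarticChain_force_dominated` — coercivity of the tilted energy, `|f q_0| ≤ H/2 + C_f`;
* `pureQuarticChain_localSmall_forcedRest` — a local small set at `x⋆` in a time window;
* `pureQuarticChain_minorization` — **Prop. 3.6 for the purely quartic chain, PROVED**, in the form
  consumed by `LangevinChainSemigroup.harris_of_H2_of_minorization` (`LangevinSemigroupHarris.lean`).

## References

* N. Cuneo, J.-P. Eckmann, M. Hairer, L. Rey-Bellet, EJP **23** (2018) no. 55 (arXiv:1712.09413),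
  Props. 3.3, 3.6 (and proof), Cor. 3.4.
* S. P. Meyn, R. L. Tweedie, *Markov Chains and Stochastic Stability* (1993), Ch. 5–6.
-/

noncomputable section

open MeasureTheory ProbabilityTheory Filter Topology Set Metric
open scoped NNReal ENNReal

namespace Literature.MathematicalPhysics.KineticTheory.HeatConduction

open Literature.MathematicalPhysics.KineticTheory Literature.Probability.Process OscillatorChain

variable {N : ℕ}

/-! ### Uniqueness of the forced rest configuration -/

/-- `∛(λ³ y) = λ ∛y` (cube each side). [folklore] -/
theorem realCbrt_mul_pow_three (c y : ℝ) : realCbrt (c ^ 3 * y) = c * realCbrt y := by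
  apply pow_three_strictMono.injective
  simp only [mul_pow, realCbrt_pow_three]

/-- **Back-substitution**: a configuration of the purely quartic chain at rest at every site
`i ≠ 0` is the dilate of the forced rest configuration by its right-end value,
`q_i = q_{N-1} · Q_{N-1-i}` (`Q₀ = 1`; the rest equations solved from the free right end have a
one-parameter family of solutions, by mechanical similarity). [folklore] -/
theorem pureQuarticChain_eq_smul_forcedRest_of_dPotential (μ γ : ℝ) (hN : 0 < N) (q : Fin N → ℝ)
    (h : ∀ i : Fin N, i ≠ ⟨0, hN⟩ → (pureQuarticChain μ γ).dPotential N i q = 0) :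
    ∀ i : Fin N, q i = q ⟨N - 1, by omega⟩ * pureQuarticForcedRest μ N i := by
  set lam := q ⟨N - 1, by omega⟩ with hlam
  -- downward induction on the distance `n` from the right end, positions and stretches together
  have key : ∀ n : ℕ, ∀ hn : n < N,
      q ⟨N - 1 - n, by omega⟩ = lam * (pureQuarticRestSeq μ n).1 ∧
        (0 < N - 1 - n → q ⟨N - 1 - n, by omega⟩ - q ⟨N - 1 - n - 1, by omega⟩ =
          lam * (pureQuarticRestSeq μ n).2) := by
    intro n
    induction n with
    | zero =>
      intro hn
      have hQ : q ⟨N - 1 - 0, by omega⟩ = lam * (pureQuarticRestSeq μ 0).1 := by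
        rw [pureQuarticRestSeq_zero]; simp [hlam]
      refine ⟨hQ, fun hpos => ?_⟩
      -- the rest equation of the right end: `μ q³ + (q - q')³ = 0`
      set i : Fin N := ⟨N - 1 - 0, by omega⟩ with hi
      have hi0 : i ≠ ⟨0, hN⟩ := fun e => by have := congrArg Fin.val e; simp [hi] at this; omega
      have e := h i hi0
      rw [(pureQuarticChain μ γ).dPotential_eq_closed N i, pureQuarticChain_deriv_U] at e
      simp only [pureQuarticChain_deriv_V] at e
      rw [dif_pos (show 0 < i.val by simp [hi]; omega), dif_neg (show ¬ (i.val + 1 < N) by simp [hi]; omega),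
        sub_zero] at e
      have hidx : (⟨i.val - 1, by omega⟩ : Fin N) = ⟨N - 1 - 0 - 1, by omega⟩ := Fin.ext (by simp [hi])
      rw [hidx] at e
      -- `(q - q')³ = -μ q³ = lam³ R₀³`
      have hqi : q i = lam := by
        rw [hlam]
        congr 1
      have hcube : (q i - q ⟨N - 1 - 0 - 1, by omega⟩) ^ 3 = (lam * (pureQuarticRestSeq μ 0).2) ^ 3 := by
        rw [mul_pow, pureQuarticRestSeq_zero_snd_pow]
        rw [hqi] at e ⊢
        linear_combination e
      exact pow_three_strictMono.injective hcube
    | succ n ih =>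
      intro hn
      obtain ⟨hQn, hRn⟩ := ih (by omega)
      have hRn' := hRn (by omega)
      -- position: `q_{n+1} = q_n - r_n`
      have hQ : q ⟨N - 1 - (n + 1), by omega⟩ = lam * (pureQuarticRestSeq μ (n + 1)).1 := by
        rw [pureQuarticRestSeq_succ_fst, mul_sub, ← hQn, ← hRn']
        have : (⟨N - 1 - n - 1, by omega⟩ : Fin N) = ⟨N - 1 - (n + 1), by omega⟩ := Fin.ext (by simp; omega)
        rw [this]
        ring
      refine ⟨hQ, fun hpos => ?_⟩
      -- the rest equation at distance `n+1`: `μ q³ + (left stretch)³ - (right stretch)³ = 0`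
      set i : Fin N := ⟨N - 1 - (n + 1), by omega⟩ with hi
      have hi0 : i ≠ ⟨0, hN⟩ := fun e => by have := congrArg Fin.val e; simp [hi] at this; omega
      have e := h i hi0
      rw [(pureQuarticChain μ γ).dPotential_eq_closed N i, pureQuarticChain_deriv_U] at e
      simp only [pureQuarticChain_deriv_V] at e
      rw [dif_pos (show 0 < i.val by simp [hi]; omega), dif_pos (show i.val + 1 < N by simp [hi]; omega)] at e
      have hidx1 : (⟨i.val - 1, by omega⟩ : Fin N) = ⟨N - 1 - (n + 1) - 1, by omega⟩ := Fin.ext (by simp [hi])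
      have hidx2 : (⟨i.val + 1, by simp [hi]; omega⟩ : Fin N) = ⟨N - 1 - n, by omega⟩ := Fin.ext (by simp [hi]; omega)
      rw [hidx1, hidx2] at e
      -- the right stretch is known
      have hright : q ⟨N - 1 - n, by omega⟩ - q i = lam * (pureQuarticRestSeq μ n).2 := by
        rw [← hRn']
        have : (⟨N - 1 - n - 1, by omega⟩ : Fin N) = i := Fin.ext (by simp [hi]; omega)
        rw [this]
      rw [hright] at e
      have hcube : (q i - q ⟨N - 1 - (n + 1) - 1, by omega⟩) ^ 3 =
          (lam * (pureQuarticRestSeq μ (n + 1)).2) ^ 3 := by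
        rw [mul_pow, pureQuarticRestSeq_succ_snd_pow]
        rw [hQ] at e ⊢
        linear_combination e
      exact pow_three_strictMono.injective hcube
  intro i
  have hn : N - 1 - i.val < N := by omega
  have h1 := (key (N - 1 - i.val) hn).1
  have hidx : (⟨N - 1 - (N - 1 - i.val), by omega⟩ : Fin N) = i := Fin.ext (by simp; omega)
  rw [hidx] at h1
  rw [h1]
  rfl

/-- The left-end force of a dilated configuration: `∂₀Φ(λ q) = λ³ ∂₀Φ(q)` (mechanical
similarity of the cubic forces). [folklore] -/
theorem pureQuarticChain_dPotential_smul (μ γ : ℝ) (lam : ℝ) (q : Fin N → ℝ) (i : Fin N) :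
    (pureQuarticChain μ γ).dPotential N i (fun j => lam * q j) = lam ^ 3 * (pureQuarticChain μ γ).dPotential N i q := by
  rw [(pureQuarticChain μ γ).dPotential_eq_closed N i, (pureQuarticChain μ γ).dPotential_eq_closed N i,
    pureQuarticChain_deriv_U, pureQuarticChain_deriv_U]
  simp only [pureQuarticChain_deriv_V]
  split_ifs <;> ring

/-- The left-end force at the forced rest configuration is positive (`μ > 0`):
`∂₀Φ(q⋆) = μ Q_{N-1}³ - R_{N-2}³ > 0` (`Q > 0`, `R < 0`). [folklore] -/
theorem pureQuarticChain_dPotential_forcedRest_zero_pos {μ : ℝ} (hμ : 0 < μ) (γ : ℝ) (hN : 0 < N) :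
    0 < (pureQuarticChain μ γ).dPotential N ⟨0, hN⟩ (pureQuarticForcedRest μ N) := by
  rw [pureQuarticChain_dPotential_apply]
  have hlt : ¬ (0 < (⟨0, hN⟩ : Fin N).val) := by simp
  rw [dif_neg hlt, add_zero]
  have hQ := (pureQuarticRestSeq_pos_neg hμ (N - 1 - 0)).1
  have hq0 : pureQuarticForcedRest μ N ⟨0, hN⟩ = (pureQuarticRestSeq μ (N - 1 - 0)).1 := rfl
  by_cases h1 : (⟨0, hN⟩ : Fin N).val + 1 < N
  · rw [dif_pos h1]
    have hsub := pureQuarticForcedRest_sub μ (N := N) (i := ⟨(⟨0, hN⟩ : Fin N).val + 1, h1⟩) (j := ⟨0, hN⟩) rfl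
    rw [hsub, hq0]
    have hR := (pureQuarticRestSeq_pos_neg hμ (N - 1 - ((⟨0, hN⟩ : Fin N).val + 1))).2
    have h3 : (pureQuarticRestSeq μ (N - 1 - ((⟨0, hN⟩ : Fin N).val + 1))).2 ^ 3 < 0 :=
      Odd.pow_neg ⟨1, by norm_num⟩ hR
    have h4 : 0 < μ * (pureQuarticRestSeq μ (N - 1 - 0)).1 ^ 3 := by positivity
    linarith
  · rw [dif_neg h1, hq0, sub_zero]
    positivity

/-- **Uniqueness of the forced rest configuration of the purely quartic chain** (`μ > 0`): if `q`
is at rest at every site `i ≠ 0` and its left-end force is that of `q⋆`, then `q = q⋆`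
(`q = λ q⋆` by back-substitution and `λ³ ∂₀Φ(q⋆) = ∂₀Φ(q⋆) > 0` forces `λ = 1`). This is the
hypothesis `huniq` of `LangevinChainForcedLaSalle.lean`. [folklore] -/
theorem pureQuarticChain_eq_forcedRest_of_dPotential {μ : ℝ} (hμ : 0 < μ) (γ : ℝ) (hN : 0 < N)
    (q : Fin N → ℝ) (h : ∀ i : Fin N, i ≠ ⟨0, hN⟩ → (pureQuarticChain μ γ).dPotential N i q = 0)
    (h0 : (pureQuarticChain μ γ).dPotential N ⟨0, hN⟩ q =
      (pureQuarticChain μ γ).dPotential N ⟨0, hN⟩ (pureQuarticForcedRest μ N)) :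
    q = pureQuarticForcedRest μ N := by
  set lam := q ⟨N - 1, by omega⟩ with hlam
  have hq : q = fun j => lam * pureQuarticForcedRest μ N j :=
    funext (pureQuarticChain_eq_smul_forcedRest_of_dPotential μ γ hN q h)
  have hF := pureQuarticChain_dPotential_forcedRest_zero_pos hμ γ hN
  rw [hq, pureQuarticChain_dPotential_smul] at h0
  have hl3 : lam ^ 3 = 1 := by
    have : (lam ^ 3 - 1) * (pureQuarticChain μ γ).dPotential N ⟨0, hN⟩ (pureQuarticForcedRest μ N) = 0 := by
      linarith
    have h2 := (mul_eq_zero.1 this).resolve_right hF.ne'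
    linarith
  have hl1 : lam = 1 := by
    have : lam ^ 3 = 1 ^ 3 := by rw [hl3, one_pow]
    exact pow_three_strictMono.injective this
  rw [hq, hl1]
  funext j
  exact one_mul _

/-! ### Coercivity of the tilted energy -/

/-- **The pull is dominated by the energy**: `|f q_0| ≤ H/2 + C_f` for the purely quartic chain
with `μ > 0` (`|f q| ≤ f²/2 + q²/2`, `q²/2 ≤ μq⁴/16 + 1/μ`, `μq_0⁴/4 ≤ H`) — the hypothesis `hdom`
of `LangevinChainForcedLaSalle.lean`. [folklore] -/
theorem pureQuarticChain_force_dominated {μ : ℝ} (hμ : 0 < μ) (γ : ℝ) (hN : 0 < N) (f : ℝ)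
    (y : PhaseSpace N) :
    |f * y.1 ⟨0, hN⟩| ≤ (pureQuarticChain μ γ).hamiltonian N y / 2 + (f ^ 2 / 2 + 1 / μ) := by
  set q := y.1 ⟨0, hN⟩ with hq
  have hU : μ * q ^ 4 / 4 ≤ (pureQuarticChain μ γ).hamiltonian N y := by
    have h := pureQuarticChain_U_le_hamiltonian hμ.le γ N y ⟨0, hN⟩
    simpa [pureQuarticChain_U] using h
  have hH0 := pureQuarticChain_hamiltonian_nonneg hμ.le γ N y
  have h1 : |f * q| ≤ f ^ 2 / 2 + q ^ 2 / 2 := by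
    rw [abs_mul]
    nlinarith [sq_nonneg (|f| - |q|), sq_abs f, sq_abs q]
  have h2 : q ^ 2 / 2 ≤ μ * q ^ 4 / 16 + 1 / μ := by
    have hμ' : 0 < μ⁻¹ := inv_pos.2 hμ
    have key : 0 ≤ μ * (q ^ 2 / 4 - μ⁻¹) ^ 2 := by positivity
    have e : μ * (q ^ 2 / 4 - μ⁻¹) ^ 2 = μ * q ^ 4 / 16 - q ^ 2 / 2 + μ⁻¹ := by
      field_simp
      ring
    rw [one_div]
    linarith
  linarith

/-! ### The local small set at the forced equilibrium -/

section Small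

variable {μ γ : ℝ} (hμ : 0 < μ) (hγ : 0 < γ) (hN : 0 < N) {T_L : ℝ} (hTL : 0 < T_L) (T_R : ℝ)
include hμ hγ hN hTL

/-- **A local small set of the purely quartic chain at its forced equilibrium, in a time window**
(Hörmander-free; `μ, γ, T_L > 0`, `N ≥ 1`, any `T_R`): there are an open neighbourhood `G₀` of
`x⋆ = (q⋆, 0)`, a non-empty open `U₀`, `η > 0` and a window `[t₀ - δ, t₀ + δ]` (`0 < δ ≤ t₀`) with
`P_t(w, ·) ≥ η Leb|_{U₀}` for all `w ∈ G₀` and `t` in the window — the forced minorisation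
(`ConfinedDrift.exists_localSmall_window_of_forced`) at the forced rest point (zero drift plus
constant left-bath control, Kalman there, `PureQuarticChainForcedEquilibrium.lean`).
[cite: CuneoEckmannHairerReyBellet2018, Prop 3.6 (proof)] -/
theorem pureQuarticChain_localSmall_forcedRest :
    ∃ (G₀ U₀ : Set (PhaseSpace N)) (η : ℝ≥0∞) (t₀ δ : ℝ), IsOpen G₀ ∧
      ((pureQuarticForcedRest μ N, 0) : PhaseSpace N) ∈ G₀ ∧
      IsOpen U₀ ∧ U₀.Nonempty ∧ 0 < η ∧ 0 < δ ∧ δ ≤ t₀ ∧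
      ∀ t : ℝ≥0, t₀ - δ ≤ (t : ℝ) → (t : ℝ) ≤ t₀ + δ → ∀ w ∈ G₀,
        η • (volume : Measure (PhaseSpace N)).restrict U₀ ≤
          (pureQuarticChain μ γ).langevinKernel N T_L T_R t w := by
  set P := pureQuarticChain μ γ with hP
  have hPc : P.IsConfining := pureQuarticChain_isConfining hμ hγ.le
  let D : ConfinedDrift (P.drift N) := (hPc.confinedDrift N).toConfinedDrift
  have hY : ContDiff ℝ 1 (P.drift N) := pureQuarticChain_contDiff_drift μ γ N
  set a : ℝ := pureQuarticForcedControl μ γ N hN T_L with ha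
  have hx₀ : P.drift N ((pureQuarticForcedRest μ N, 0) : PhaseSpace N) + a • P.bathVecL N T_L = 0 :=
    pureQuarticChain_drift_forcedRest T_L hγ hN hTL
  have hv₁ : P.bathVecL N T_L ∈ D.noise := hPc.bathVec_mem_noise N 0 _
  have hv₂ : P.bathVecR N T_R ∈ D.noise := hPc.bathVec_mem_noise N (N - 1) _
  have hK₁ : 0 ≤ |a| * Real.sqrt (2 * γ * T_L) := by positivity
  have hgrow : ∀ y, fderiv ℝ D.V y (a • P.bathVecL N T_L) ≤ |a| * Real.sqrt (2 * γ * T_L) * (D.V y + D.c) := by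
    intro y
    have h := pureQuarticChain_fderiv_hamiltonian_bathVecL_le (γ := γ) T_L hμ.le hN a y
    show fderiv ℝ (P.hamiltonian N) y (a • P.bathVecL N T_L) ≤ |a| * Real.sqrt (2 * γ * T_L) * (P.hamiltonian N y + 1)
    exact h
  have hKal : ∀ ℓ : PhaseSpace N →ₗ[ℝ] ℝ,
      (∀ k : ℕ, ℓ (((fderiv ℝ (P.drift N) ((pureQuarticForcedRest μ N, 0) : PhaseSpace N)) ^ k)
        (P.bathVecL N T_L)) = 0) → ℓ = 0 :=
    fun ℓ h => pureQuarticChain_kalman_forcedRest T_L hμ hγ hN hTL ℓ h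
  haveI hpi : (volume : Measure (Fin N → ℝ)).IsAddHaarMeasure := isAddHaarMeasure_volume_pi _
  haveI : (volume : Measure (PhaseSpace N)).IsAddHaarMeasure :=
    Measure.prod.instIsAddHaarMeasure (volume : Measure (Fin N → ℝ)) (volume : Measure (Fin N → ℝ))
  obtain ⟨G₀, U₀, η, t₀, δ, hG₀, h0, hU₀, hU₀ne, hη, hδ, hδt, hmin⟩ :=
    D.exists_localSmall_window_of_forced hY hv₁ hv₂ hx₀ hK₁ hgrow hKal (volume : Measure (PhaseSpace N))
  exact ⟨G₀, U₀, η, t₀, δ, hG₀, h0, hU₀, hU₀ne, hη, hδ, hδt, hmin⟩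

/-- **Cuneo–Eckmann–Hairer–Rey-Bellet 2018, Proposition 3.6 for the purely quartic chain, PROVED
unconditionally** (`μ, γ, T_L > 0`, any `T_R`, `N ≥ 1`). Printed: "for every compact set `C`,
there exists a time `t_C` such that for all `t ≥ t_C`, there exists a non-negative and non-trivial
measure `ν` (which may depend on `t`) such that `P_t(z, ·) ≥ ν` for all `z ∈ C`." For the
transition kernels `langevinKernel` of the SDE (2.2): the local small set at the forced equilibrium
(`pureQuarticChain_localSmall_forcedRest`) is propagated to every compact set by the Feller
property and the pointed irreducibility towards the forced rest point
(`OscillatorChain.IsConfining.exists_langevinKernel_pos_of_forced_mem`: forced LaSalle + support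
theorem), through the abstract small-set theorem
`Literature.Probability.Process.MarkovSemigroup.exists_smul_le_of_isCompact_of_mem`.
[cite: CuneoEckmannHairerReyBellet2018, Prop 3.6] -/
theorem pureQuarticChain_minorization :
    ∀ C : Set (PhaseSpace N), IsCompact C → ∃ t_C : ℝ≥0, ∀ t : ℝ≥0, t_C ≤ t →
      ∃ ν : Measure (PhaseSpace N), ν ≠ 0 ∧
        ∀ z ∈ C, ν ≤ (pureQuarticChain μ γ).langevinKernel N T_L T_R t z := by
  intro C hC
  set P := pureQuarticChain μ γ with hP
  have hPc : P.IsConfining := pureQuarticChain_isConfining hμ hγ.le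
  set κ := P.langevinKernel N T_L T_R with hκ
  haveI : ∀ t, IsMarkovKernel (κ t) := fun t => hPc.isMarkovKernel_langevinKernel N T_L T_R t
  have h_add : ∀ s t : ℝ≥0, κ (s + t) = κ t ∘ₖ κ s := hPc.langevinKernel_add N T_L T_R
  have h_feller : ∀ (t : ℝ≥0) (g : BoundedContinuousFunction (PhaseSpace N) ℝ),
      Continuous fun x => ∫ y, g y ∂(κ t x) := fun t g =>
    hPc.continuous_integral_langevinKernel_bcf N T_L T_R t g
  -- irreducibility towards the forced rest point (forced LaSalle)
  set f : ℝ := P.dPotential N ⟨0, hN⟩ (pureQuarticForcedRest μ N) with hf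
  have hγ' : 0 < P.γ := by simpa [hP] using hγ
  have h_irred : ∀ (z : PhaseSpace N) (U : Set (PhaseSpace N)), IsOpen U →
      ((pureQuarticForcedRest μ N, 0) : PhaseSpace N) ∈ U → ∃ t : ℝ≥0, 0 < κ t z U :=
    fun z U hU hx => hPc.exists_langevinKernel_pos_of_forced_mem N hN f
      (Cf := f ^ 2 / 2 + 1 / μ) (fun y => pureQuarticChain_force_dominated hμ γ hN f y) hγ'
      (pureQuarticChain_deriv_V_injective μ γ)
      (qstar := pureQuarticForcedRest μ N)
      (fun q hq h0 => pureQuarticChain_eq_forcedRest_of_dPotential hμ γ hN q hq h0) hTL T_R z U hU hx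
  -- the local small set at the forced rest point
  obtain ⟨G₀, U₀, η, t₀, δ, hG₀, h0, hU₀, ⟨y₀, hy₀⟩, hη, hδ, hδt, hloc⟩ :=
    pureQuarticChain_localSmall_forcedRest hμ hγ hN hTL T_R
  have hν₀ : ∀ V : Set (PhaseSpace N), IsOpen V → y₀ ∈ V →
      0 < (η • (volume : Measure (PhaseSpace N)).restrict U₀) V := by
    intro V hV hyV
    rw [Measure.smul_apply, Measure.restrict_apply hV.measurableSet, smul_eq_mul]
    exact ENNReal.mul_pos hη.ne' ((hV.inter hU₀).measure_pos volume ⟨y₀, hyV, hy₀⟩).ne'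
  obtain ⟨t_C, ht_C⟩ := MarkovSemigroup.exists_smul_le_of_isCompact_of_mem κ h_add h_feller h_irred
    hG₀ h0 hν₀ hδ hδt hloc hC
  refine ⟨t_C, fun t ht => ?_⟩
  obtain ⟨ε, hε0, -, hε⟩ := ht_C t ht
  refine ⟨ε • (η • (volume : Measure (PhaseSpace N)).restrict U₀), fun h0m => ?_, hε⟩
  have hpos := hν₀ univ isOpen_univ (mem_univ _)
  have : (ε • (η • (volume : Measure (PhaseSpace N)).restrict U₀)) univ = 0 := by rw [h0m]; rfl
  rw [Measure.smul_apply, smul_eq_mul, mul_eq_zero] at this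
  exact this.elim (fun h => hε0.ne' h) (fun h => hpos.ne' h)

end Small

end Literature.MathematicalPhysics.KineticTheory.HeatConduction

end
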